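import Literature.RepresentationTheory.CompactGroups.CompactSemisimpleUniversalCover
import Literature.RepresentationTheory.CompactGroups.PeterWeylSeparation
import Literature.RepresentationTheory.CompactGroups.SemisimpleCommutatorDense
import Literature.RepresentationTheory.CompactGroups.FaithfulRepCharts
import Literature.Topology.CoveringSpaces.UniversalCoverGroupCharacters
import HarnessLib

/-!
# Proof of `CompactSemisimpleUniversalCover` (Weyl's covering theorem)

Topic `Literature/RepresentationTheory/CompactGroups`.  Discharge of the named fact
`Literature.RepresentationTheory.CompactGroups.CompactSemisimpleUniversalCover`
(`CompactSemisimpleUniversalCover.lean`; T. Bröcker, T. tom Dieck, *Representations of Compact Lie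
Groups* (1985), V Thm. (7.1) with Remark (7.13) (i) ⇒ (iii) ⇒ (iv), and III (4.1)): a compact
connected topological group `G` with a faithful continuous unitary matrix representation and no
non-trivial closed connected abelian normal subgroup has a compact simply connected covering
group `π : G̃ → G` with finite kernel, and `G̃` again has a faithful continuous unitary matrix
representation.  Everything here is proved (no definitions, no named facts):

* `exists_unitaryRep_blockSum` — block sum of two continuous unitary matrix representations;
* `exists_faithful_unitaryRep_of_finite_ker` — a compact Hausdorff group mapping with finite
  kernel onto a faithfully represented group has a faithful continuous unitary representation
  (Peter–Weyl point separation, `PeterWeyl.exists_unitary_rep_apply_ne_one`);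
* **`CompactSemisimpleUniversalCover_holds`** — the theorem.

## References

* T. Bröcker, T. tom Dieck, *Representations of Compact Lie Groups*, GTM 98, Springer 1985,
  V (7.1), (7.13), III (4.1). [BrockerTomDieck1985]
* M. R. Sepanski, *Compact Lie Groups*, GTM 235, Springer 2007, Thm. 1.22, Cor. 6.33. [Sepanski2007]
-/

noncomputable section

open Matrix
open Literature.Topology.CoveringSpaces Literature.Topology.CoveringSpaces.UniversalCover

namespace Literature.RepresentationTheory.CompactGroups

/-! ### Proof

Weyl's covering theorem is assembled from four proved ingredients of the tree (all theorems):

1. `MatrixLie.topology_of_faithful` (`FaithfulRepCharts.lean`): `G` is a compact topological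
   manifold (charts `log ∘ σ`, von Neumann's theorem `MatrixLie.exists_chart`), hence Hausdorff,
   path connected, strongly locally contractible, with finitely generated `π₁(G, 1)`.
2. `MatrixLie.monoidHom_eq_one_of_faithful` (`SemisimpleCommutatorDense.lean`): the semisimplicity
   hypothesis makes the Lie algebra centreless, the commutator subgroup dense, and every
   continuous character `G →* Circle` trivial.
3. `UniversalCover.finite_fundamentalGroup_of_forall_character`
   (`Topology/CoveringSpaces/UniversalCoverGroupCharacters.lean`): then `π₁(G, 1) ≅ ker p` is a
   finitely generated abelian group without homomorphisms to `ℤ` (a homomorphism would extend to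
   a continuous `G̃ → ℝ` by the Haar-averaging splitting of the induced `ℝ`-extension and descend
   to a character of `G`), hence finite; so the universal covering group `p : G̃ →* G`
   (`UniversalCoverGroup.lean`) is compact, simply connected, with finite kernel.
4. `PeterWeyl.exists_unitary_rep_apply_ne_one` (`PeterWeylSeparation.lean`): finite-dimensional
   unitary representations of the compact group `G̃` separate the finitely many non-trivial
   kernel elements from `1`; their block sum with `ρ ∘ p` is faithful.

This replaces the book's road (Bröcker–tom Dieck V (7.1): Stiefel diagram, `π₁(G) ≅ I/Γ`) by the
cohomological one; the statement proved is exactly V (7.13) (i) ⇒ (iv) with III (4.1). -/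


/-- **Block sum of two continuous unitary matrix representations** (reindexed to `Fin (a + b)`):
continuous, unitary, and trivial at `h` only if both summands are. [folklore] -/
theorem exists_unitaryRep_blockSum {H : Type*} [Group H] [TopologicalSpace H] {a b : ℕ}
    (σ₁ : H →* Matrix (Fin a) (Fin a) ℂ) (σ₂ : H →* Matrix (Fin b) (Fin b) ℂ)
    (h₁c : Continuous σ₁) (h₂c : Continuous σ₂)
    (h₁u : ∀ h, σ₁ h ∈ Matrix.unitaryGroup (Fin a) ℂ)
    (h₂u : ∀ h, σ₂ h ∈ Matrix.unitaryGroup (Fin b) ℂ) :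
    ∃ σ : H →* Matrix (Fin (a + b)) (Fin (a + b)) ℂ, Continuous σ ∧
      (∀ h, σ h ∈ Matrix.unitaryGroup (Fin (a + b)) ℂ) ∧ ∀ h, σ h = 1 → σ₁ h = 1 ∧ σ₂ h = 1 := by
  classical
  let blk : H →* Matrix (Fin a ⊕ Fin b) (Fin a ⊕ Fin b) ℂ :=
    { toFun := fun h => Matrix.fromBlocks (σ₁ h) 0 0 (σ₂ h)
      map_one' := by rw [map_one, map_one, Matrix.fromBlocks_one]
      map_mul' := fun x y => by
        rw [map_mul, map_mul, Matrix.fromBlocks_multiply]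
        simp }
  have hblk : ∀ h, blk h = Matrix.fromBlocks (σ₁ h) 0 0 (σ₂ h) := fun h => rfl
  let R := Matrix.reindexAlgEquiv ℂ ℂ (finSumFinEquiv : Fin a ⊕ Fin b ≃ Fin (a + b))
  let σ : H →* Matrix (Fin (a + b)) (Fin (a + b)) ℂ := R.toAlgHom.toMonoidHom.comp blk
  have hσ : ∀ h, σ h = R (blk h) := fun h => rfl
  have hσ' : ∀ h, σ h = (blk h).submatrix finSumFinEquiv.symm finSumFinEquiv.symm := fun h => rfl
  refine ⟨σ, ?_, fun h => ?_, fun h hh => ?_⟩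
  · have h1 : Continuous fun h => blk h := by
      simp only [hblk]
      exact Continuous.matrix_fromBlocks h₁c continuous_const continuous_const h₂c
    have : (σ : H → Matrix (Fin (a + b)) (Fin (a + b)) ℂ) =
        fun h => (blk h).submatrix finSumFinEquiv.symm finSumFinEquiv.symm := funext hσ'
    rw [this]
    exact h1.matrix_submatrix _ _
  · have hu : blk h * star (blk h) = 1 := by
      rw [hblk, Matrix.star_eq_conjTranspose, Matrix.fromBlocks_conjTranspose,
        Matrix.fromBlocks_multiply]
      have e1 : σ₁ h * (σ₁ h)ᴴ = 1 := by
        have := Matrix.mem_unitaryGroup_iff.1 (h₁u h)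
        rwa [Matrix.star_eq_conjTranspose] at this
      have e2 : σ₂ h * (σ₂ h)ᴴ = 1 := by
        have := Matrix.mem_unitaryGroup_iff.1 (h₂u h)
        rwa [Matrix.star_eq_conjTranspose] at this
      simp [e1, e2, Matrix.fromBlocks_one]
    rw [Matrix.mem_unitaryGroup_iff]
    have hstar : star (σ h) = R (star (blk h)) := by
      rw [hσ', Matrix.star_eq_conjTranspose, Matrix.conjTranspose_submatrix,
        Matrix.star_eq_conjTranspose]
      rfl
    rw [hstar, hσ, ← map_mul, hu, map_one]
  · have h1 : blk h = 1 := R.injective (by rw [← hσ, hh, map_one])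
    rw [hblk, ← Matrix.fromBlocks_one, Matrix.fromBlocks_inj] at h1
    exact ⟨h1.1, h1.2.2.2⟩

/-- **A faithful unitary representation of a compact group which is a finite extension of a
faithfully represented group**: if `p : H →* G` is continuous with finite kernel, `ρ` is a
continuous unitary faithful representation of `G`, and `H` is compact Hausdorff, then `H` has a
continuous unitary faithful representation — the block sum of `ρ ∘ p` with finitely many
representations separating the non-trivial kernel elements from `1` (Peter–Weyl,
`PeterWeyl.exists_unitary_rep_apply_ne_one`; Bröcker–tom Dieck III (4.1)).
[cite: BrockerTomDieck1985, III (4.1)] -/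
theorem exists_faithful_unitaryRep_of_finite_ker {H G : Type*} [Group H] [TopologicalSpace H]
    [IsTopologicalGroup H] [CompactSpace H] [T2Space H] [Group G] [TopologicalSpace G]
    (p : H →* G) (hp : Continuous p) (hker : (p.ker : Set H).Finite) {N : ℕ}
    (ρ : G →* Matrix (Fin N) (Fin N) ℂ) (hρ : Continuous ρ) (hinj : Function.Injective ρ)
    (hunit : ∀ g, ρ g ∈ Matrix.unitaryGroup (Fin N) ℂ) :
    ∃ (M : ℕ) (σ : H →* Matrix (Fin M) (Fin M) ℂ), Continuous σ ∧ Function.Injective σ ∧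
      ∀ h, σ h ∈ Matrix.unitaryGroup (Fin M) ℂ := by
  classical
  -- induction over finite sets of kernel elements to be separated from `1`
  have key : ∀ s : Finset H, ∃ (M : ℕ) (σ : H →* Matrix (Fin M) (Fin M) ℂ), Continuous σ ∧
      (∀ h, σ h ∈ Matrix.unitaryGroup (Fin M) ℂ) ∧
      ∀ h, σ h = 1 → h ∈ p.ker ∧ ∀ k ∈ s, k ≠ 1 → h ≠ k := by
    intro s
    induction s using Finset.induction_on with
    | empty =>
      refine ⟨N, ρ.comp p, hρ.comp hp, fun h => hunit (p h), fun h hh => ⟨?_, fun k hk => absurd hk (Finset.notMem_empty k)⟩⟩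
      rw [MonoidHom.mem_ker]
      exact hinj (by rw [map_one]; exact hh)
    | insert k s hks ih =>
      obtain ⟨M, σ, hσc, hσu, hσ⟩ := ih
      by_cases hk1 : k = 1
      · refine ⟨M, σ, hσc, hσu, fun h hh => ⟨(hσ h hh).1, fun k' hk' hk'1 => ?_⟩⟩
        rcases Finset.mem_insert.1 hk' with rfl | hk's
        · exact absurd hk1 hk'1
        · exact (hσ h hh).2 k' hk's hk'1
      · obtain ⟨n, τ, hτc, hτu, hτk⟩ := PeterWeyl.exists_unitary_rep_apply_ne_one (G := H) hk1
        obtain ⟨σ', hσ'c, hσ'u, hσ'⟩ := exists_unitaryRep_blockSum σ τ hσc hτc hσu hτu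
        refine ⟨M + n, σ', hσ'c, hσ'u, fun h hh => ⟨(hσ h (hσ' h hh).1).1, fun k' hk' hk'1 => ?_⟩⟩
        rcases Finset.mem_insert.1 hk' with rfl | hk's
        · rintro rfl
          exact hτk (hσ' _ hh).2
        · exact (hσ h (hσ' h hh).1).2 k' hk's hk'1
  obtain ⟨M, σ, hσc, hσu, hσ⟩ := key hker.toFinset
  refine ⟨M, σ, hσc, (injective_iff_map_eq_one σ).2 fun h hh => ?_, hσu⟩
  obtain ⟨hhK, hsep⟩ := hσ h hh
  by_contra hne
  exact hsep h (hker.mem_toFinset.2 hhK) hne rfl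

/-- **Weyl's covering theorem** (`CompactSemisimpleUniversalCover` holds): a compact connected
group with a faithful continuous unitary matrix representation and no non-trivial closed
connected abelian normal subgroup has a compact simply connected covering group with finite
kernel, which again has a faithful continuous unitary matrix representation (Bröcker–tom Dieck
V (7.13) (i) ⇒ (iii) ⇒ (iv) with III (4.1); here: the universal covering group of the tree,
compact because `π₁(G, 1)` is finite by the character criterion, faithfully represented by
Peter–Weyl). [cite: BrockerTomDieck1985, V Thm (7.1) and Remark (7.13); III (4.1)] -/
theorem CompactSemisimpleUniversalCover_holds : CompactSemisimpleUniversalCover := by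
  intro G _ _ _ _ _ N ρ hρ hinj hunit hss
  obtain ⟨hT2, hpc, hslc, hfg⟩ := MatrixLie.topology_of_faithful N ρ hρ hinj
  haveI := hT2
  haveI := hpc
  haveI := hslc
  haveI := hfg
  have hχ : ∀ χ : G →* Circle, Continuous χ → χ = 1 := fun χ hχc =>
    MatrixLie.monoidHom_eq_one_of_faithful N ρ hρ hinj hss χ hχc
  haveI : Finite (FundamentalGroup G (1 : G)) := finite_fundamentalGroup_of_forall_character hχ
  haveI : CompactSpace (UniversalCover G (1 : G)) := compactSpace_of_finite
  haveI : T2Space (UniversalCover G (1 : G)) := UniversalCover.t2Space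
  have hker : ((projHom (G := G)).ker : Set (UniversalCover G (1 : G))).Finite := finite_ker_projHom
  obtain ⟨M, σ, hσc, hσinj, hσu⟩ := exists_faithful_unitaryRep_of_finite_ker (projHom (G := G))
    continuous_projHom hker ρ hρ hinj hunit
  exact ⟨UniversalCover G (1 : G), inferInstance, inferInstance, inferInstance, inferInstance,
    projHom, inferInstance, continuous_projHom, projHom_surjective, hker, M, σ, hσc, hσinj, hσu⟩


end Literature.RepresentationTheory.CompactGroups
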